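import Summits.RiemannHypothesis.RiemannHypothesis.Theses.WeilComb
import Summits.RiemannHypothesis.RiemannHypothesis.Theorems.WeilCombCombSubcriticalStubAutocorrelation
import Summits.RiemannHypothesis.RiemannHypothesis.Theorems.WeilCombCombShapeAdmissible
import Literature.NumberTheory.LFunctions.WeilExplicit
import Literature.NumberTheory.LFunctions.WeilMellinBounds
import Literature.NumberTheory.LFunctions.WeilWindowSimpleEven
import Literature.NumberTheory.LFunctions.WeilGroundEnergyProofs

/-!
# Stub `stub_gram` of line `Sketch` for crux `WeilComb.CombShapePositivity`
(item stmt-RiemannHypothesis-11229, route route-RiemannHypothesis-WeilComb)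

The GRAM IDENTITY for the fixed-shape log-integer comb. Notation: `φ₀(u) = expNegInvGlue (1 - u²)`
(the route's fixed bump, a Weil test by `weilComb_shapeBump_isWeilTest`), `φ_ε(t) = ε⁻¹ φ₀(t/ε)`,
`ψ_ε = φ_ε ⋆ φ̃_ε` (`weilConv` / `weilReflect`), `τ_x h = weilTranslate h x = h(· − x)`, comb
`g(x) = Σ_{m ≤ M} a_m φ_ε(x − log m)`, `Q(g) = weilQuadratic g = W(g ⋆ g̃)` with `W = weilFunctional`.

**Statement.** For `ε > 0`,
`Q(g) = Σ_{m, m' ∈ [1, M]} a_m conj(a_{m'}) W(τ_{log m − log m'} ψ_ε)`.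

**Proof.** `Q(g) = W(g ⋆ g̃)` by definition. The comb autocorrelation
`g ⋆ g̃ = Σ_{m,m'} a_m conj(a_{m'}) τ_{log m − log m'} ψ_ε` (as functions) is the in-tree
`WeilCombSubcritical.stub_autocorrelation` instantiated at `φ := φ₀`. Each summand
`t ↦ a_m conj(a_{m'}) (τ_{log m − log m'} ψ_ε)(t)` is a Weil test (`ψ_ε` is one, being the
convolution of the test `φ_ε` with its reflection; translates and scalar multiples of tests are
tests), so `W` distributes over the finite double sum (`weilFunctional_add` by induction on the
`Finset`, the empty case being `W(0) = 0`), and finally `W(c k) = c W(k)`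
(`weilFunctional_const_mul`).
-/

noncomputable section

-- the sub-problem path RiemannHypothesis/RiemannHypothesis duplicates a namespace (D-0017)
set_option linter.dupNamespace false

open scoped BigOperators ComplexConjugate
open Complex MeasureTheory Set

namespace Summit.RiemannHypothesis.RiemannHypothesis.Theorems.WeilCombBohrFejer

open Literature.NumberTheory.LFunctions

/-- `φ_ε = ε⁻¹ φ(·/ε)` is a Weil test function for `ε ≠ 0` (smoothness of `t ↦ t/ε`; the support is
the image of a compact set under the homeomorphism `t ↦ ε t`). [folklore] -/
private theorem isWeilTest_dil {φ : ℝ → ℂ} {ε : ℝ} (hφ : IsWeilTest φ) (hε : ε ≠ 0) :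
    IsWeilTest (fun t : ℝ => (ε : ℂ)⁻¹ * φ (t / ε)) := by
  -- adapted from `WeilCombSubcritical.isWeilTest_dil_autocorr` (private there)
  have h1 : IsWeilTest (fun t : ℝ => φ (t / ε)) := by
    refine ⟨hφ.1.comp (contDiff_id.div_const ε), ?_⟩
    have e : (fun t : ℝ => φ (t / ε)) = φ ∘ (Homeomorph.mulRight₀ ε⁻¹ (inv_ne_zero hε)) := by
      ext t
      simp [div_eq_mul_inv]
    rw [e]
    exact hφ.2.comp_homeomorph _
  exact h1.const_mul _

/-- `W(0) = 0` (from the hypothesis-free homogeneity `W(c k) = c W(k)` at `c = 0`). [folklore] -/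
private theorem weilFunctional_zero_fun : weilFunctional (fun _ : ℝ => (0 : ℂ)) = 0 := by
  have h := weilFunctional_const_mul 0 (fun _ : ℝ => (0 : ℂ))
  simp only [zero_mul] at h
  exact h

/-- A finite sum of Weil test functions is a Weil test function. [folklore] -/
private theorem isWeilTest_finset_sum {ι : Type*} (s : Finset ι) {F : ι → ℝ → ℂ}
    (hF : ∀ i ∈ s, IsWeilTest (F i)) : IsWeilTest (fun t => ∑ i ∈ s, F i t) := by
  classical
  induction s using Finset.induction_on with
  | empty =>
    simp only [Finset.sum_empty]
    exact ⟨contDiff_const, HasCompactSupport.zero⟩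
  | insert a s ha ih =>
    have h1 : IsWeilTest (F a) := hF a (Finset.mem_insert_self a s)
    have h2 : IsWeilTest (fun t => ∑ i ∈ s, F i t) :=
      ih fun i hi => hF i (Finset.mem_insert_of_mem hi)
    have h := h1.add h2
    convert h using 1
    funext t
    simp [Finset.sum_insert ha]

/-- `W` is additive over finite sums of Weil test kernels: `W(Σ_{i ∈ s} Fᵢ) = Σ_{i ∈ s} W(Fᵢ)`
(induction on `s` with `weilFunctional_add`; the empty sum is `W(0) = 0`). [folklore] -/
private theorem weilFunctional_finset_sum {ι : Type*} (s : Finset ι) {F : ι → ℝ → ℂ}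
    (hF : ∀ i ∈ s, IsWeilTest (F i)) :
    weilFunctional (fun t => ∑ i ∈ s, F i t) = ∑ i ∈ s, weilFunctional (F i) := by
  classical
  induction s using Finset.induction_on with
  | empty =>
    simp only [Finset.sum_empty]
    exact weilFunctional_zero_fun
  | insert a s ha ih =>
    have h1 : IsWeilTest (F a) := hF a (Finset.mem_insert_self a s)
    have hF' : ∀ i ∈ s, IsWeilTest (F i) := fun i hi => hF i (Finset.mem_insert_of_mem hi)
    have h2 : IsWeilTest (fun t => ∑ i ∈ s, F i t) := isWeilTest_finset_sum s hF'
    have e : (fun t => ∑ i ∈ insert a s, F i t) = F a + fun t => ∑ i ∈ s, F i t := by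
      funext t
      simp [Finset.sum_insert ha]
    rw [e, weilFunctional_add h1 h2, ih hF', Finset.sum_insert ha]

/-- **Stub 1 — Gram identity.** For `ε > 0`, the Weil quadratic functional of the fixed-shape comb is
the Hermitian multiplicative-Toeplitz form of the comb symbol `w_ε(x) = W(τ_x ψ_ε)` on the nodes `log m`:
`Q(g) = Σ_{m,m' ≤ M} a_m conj(a_{m'}) W(τ_{log m − log m'} (φ_ε ⋆ φ̃_ε))`. [folklore] -/
theorem stub_gram : ∀ ε : ℝ, 0 < ε → ∀ (M : ℕ) (a : ℕ → ℂ),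
    weilQuadratic (fun x : ℝ => ∑ m ∈ Finset.Icc 1 M,
        a m * ((ε : ℂ)⁻¹ * ((expNegInvGlue (1 - ((x - Real.log (m : ℝ)) / ε) ^ 2) : ℝ) : ℂ))) =
      ∑ m ∈ Finset.Icc 1 M, ∑ m' ∈ Finset.Icc 1 M,
        a m * conj (a m') *
          weilFunctional (weilTranslate
            (weilConv (fun t : ℝ => (ε : ℂ)⁻¹ * ((expNegInvGlue (1 - (t / ε) ^ 2) : ℝ) : ℂ))
              (weilReflect (fun t : ℝ => (ε : ℂ)⁻¹ * ((expNegInvGlue (1 - (t / ε) ^ 2) : ℝ) : ℂ))))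
            (Real.log (m : ℝ) - Real.log (m' : ℝ))) := by
  intro ε hε M a
  -- the fixed bump `φ₀` is a Weil test, hence so are `φ_ε` and `ψ_ε = φ_ε ⋆ φ̃_ε`
  have hφ : IsWeilTest (fun u : ℝ => ((expNegInvGlue (1 - u ^ 2) : ℝ) : ℂ)) :=
    Summit.RiemannHypothesis.RiemannHypothesis.Theorems.weilComb_shapeBump_isWeilTest
  have hdil : IsWeilTest (fun t : ℝ => (ε : ℂ)⁻¹ * ((expNegInvGlue (1 - (t / ε) ^ 2) : ℝ) : ℂ)) :=
    isWeilTest_dil hφ hε.ne'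
  have hψ : IsWeilTest
      (weilConv (fun t : ℝ => (ε : ℂ)⁻¹ * ((expNegInvGlue (1 - (t / ε) ^ 2) : ℝ) : ℂ))
        (weilReflect (fun t : ℝ => (ε : ℂ)⁻¹ * ((expNegInvGlue (1 - (t / ε) ^ 2) : ℝ) : ℂ)))) :=
    hdil.weilConv hdil.weilReflect
  -- the comb autocorrelation `g ⋆ g̃ = Σ a_m conj(a_{m'}) τ_{log m − log m'} ψ_ε`
  have hauto :=
    Summit.RiemannHypothesis.RiemannHypothesis.Theorems.WeilCombSubcritical.stub_autocorrelation
      (fun u : ℝ => ((expNegInvGlue (1 - u ^ 2) : ℝ) : ℂ)) hφ ε hε M a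
  beta_reduce at hauto
  rw [weilQuadratic, hauto]
  -- distribute `W` over the double sum, then pull out the scalars
  rw [weilFunctional_finset_sum _ fun m _ =>
    isWeilTest_finset_sum _ fun m' _ => (hψ.weilTranslate _).const_mul _]
  refine Finset.sum_congr rfl fun m _ => ?_
  rw [weilFunctional_finset_sum _ fun m' _ => (hψ.weilTranslate _).const_mul _]
  refine Finset.sum_congr rfl fun m' _ => ?_
  exact weilFunctional_const_mul _ _

end Summit.RiemannHypothesis.RiemannHypothesis.Theorems.WeilCombBohrFejer

end
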